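import Summits.Ventures.PercRepro.Decide

/-!
# A kernel-cheap decision procedure for connectivity: breadth-first reach sets

typer-1's `instDecidableRelConn` decides `G.Conn ω u v` through Mathlib's decidable `Reachable`,
which is correct but expensive under `decide +kernel` (it was the bottleneck of a 256-configuration
table on a 6-vertex graph). Here connectivity is decided by iterating the open-neighbour expansion
`Fintype.card V` times from `u` (`reach`): `v ∈ reach ω u ↔ G.Conn ω u v` (`mem_reach_iff`), and
`connD ω u v := decide (v ∈ reach ω u)` equals `decide (G.Conn ω u v)` for any decidability
instance (`connD_eq_decide`). The proof: every vertex reached is connected (soundness by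
induction on the number of rounds); the reach sets increase, so by counting they stabilise within
`Fintype.card V` rounds, and a stable set is closed under open adjacency, hence contains every
vertex connected to `u` (completeness by induction along the open path).
-/

namespace PercRepro

namespace MultiGraph

open Finset

variable {V E : Type*} (G : MultiGraph V E) [DecidableEq V] [Fintype V] [Fintype E]

/-- One breadth-first round: the set together with all its open neighbours. -/
def expand (ω : Config E) (s : Finset V) : Finset V :=
  s ∪ Finset.univ.filter fun v => ∃ u ∈ s, G.OpenAdj ω u v

/-- The vertices reached from `u` in at most `n` rounds. -/
def reachN (ω : Config E) (u : V) : ℕ → Finset V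
  | 0 => {u}
  | n + 1 => G.expand ω (reachN ω u n)

/-- The vertices reached from `u` in at most `Fintype.card V` rounds: the open cluster of `u`. -/
def reach (ω : Config E) (u : V) : Finset V := G.reachN ω u (Fintype.card V)

/-- Computable connectivity: `v` lies in the reach set of `u`. -/
def connD (ω : Config E) (u v : V) : Bool := decide (v ∈ G.reach ω u)

variable {G}

/-- The recursion of `reachN`. -/
theorem reachN_succ (ω : Config E) (u : V) (n : ℕ) :
    G.reachN ω u (n + 1) = G.expand ω (G.reachN ω u n) := rfl

/-- The start of `reachN`. -/
theorem reachN_zero (ω : Config E) (u : V) : G.reachN ω u 0 = {u} := rfl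

/-- A set is contained in its expansion. -/
theorem subset_expand (ω : Config E) (s : Finset V) : s ⊆ G.expand ω s :=
  Finset.subset_union_left

/-- Membership in an expansion. -/
theorem mem_expand {ω : Config E} {s : Finset V} {v : V} :
    v ∈ G.expand ω s ↔ v ∈ s ∨ ∃ u ∈ s, G.OpenAdj ω u v := by
  simp [expand]

/-- Soundness: every vertex reached is connected to the source. -/
theorem conn_of_mem_reachN {ω : Config E} {u : V} : ∀ {n : ℕ} {v : V},
    v ∈ G.reachN ω u n → G.Conn ω u v := by
  intro n
  induction n with
  | zero =>
    intro v hv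
    rw [reachN_zero, Finset.mem_singleton] at hv
    rw [hv]
    exact Conn.refl G ω u
  | succ n ih =>
    intro v hv
    rw [reachN_succ] at hv
    rcases mem_expand.1 hv with h | ⟨w, hw, hwv⟩
    · exact ih h
    · exact (ih hw).trans (Conn.of_openAdj hwv)

/-- The reach sets increase with the number of rounds. -/
theorem reachN_subset_succ (ω : Config E) (u : V) (n : ℕ) :
    G.reachN ω u n ⊆ G.reachN ω u (n + 1) := by
  rw [reachN_succ]
  exact subset_expand ω _

/-- A round that changes nothing: every later round changes nothing either. -/
theorem reachN_eq_of_fix {ω : Config E} {u : V} {n : ℕ}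
    (h : G.reachN ω u (n + 1) = G.reachN ω u n) : ∀ k, G.reachN ω u (n + k) = G.reachN ω u n := by
  intro k
  induction k with
  | zero => rfl
  | succ k ih =>
    rw [← Nat.add_assoc, reachN_succ, ih, ← reachN_succ]
    exact h

/-- Before stabilisation the reach sets grow by at least one vertex per round. -/
theorem le_card_reachN {ω : Config E} {u : V} :
    ∀ n, (∀ m < n, G.reachN ω u (m + 1) ≠ G.reachN ω u m) → n + 1 ≤ (G.reachN ω u n).card := by
  intro n
  induction n with
  | zero =>
    intro _
    rw [reachN_zero, Finset.card_singleton]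
  | succ n ih =>
    intro h
    have h1 := ih fun m hm => h m (Nat.lt_succ_of_lt hm)
    have hss : G.reachN ω u n ⊂ G.reachN ω u (n + 1) :=
      Finset.ssubset_iff_subset_ne.2 ⟨reachN_subset_succ ω u n, (h n (Nat.lt_succ_self n)).symm⟩
    have := Finset.card_lt_card hss
    omega

/-- The reach sets stabilise within `Fintype.card V` rounds. -/
theorem exists_reachN_fix (ω : Config E) (u : V) :
    ∃ n ≤ Fintype.card V, G.reachN ω u (n + 1) = G.reachN ω u n := by
  by_contra hcon
  have hcon' : ∀ m < Fintype.card V + 1, G.reachN ω u (m + 1) ≠ G.reachN ω u m :=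
    fun m hm h => hcon ⟨m, Nat.lt_succ_iff.1 hm, h⟩
  have h := le_card_reachN (G := G) (ω := ω) (u := u) (Fintype.card V + 1) hcon'
  have := Finset.card_le_univ (G.reachN ω u (Fintype.card V + 1))
  omega

/-- The final reach set is stable under expansion. -/
theorem expand_reach (ω : Config E) (u : V) : G.expand ω (G.reach ω u) = G.reach ω u := by
  obtain ⟨n, hn, hfix⟩ := exists_reachN_fix (G := G) ω u
  unfold reach
  obtain ⟨k, hk⟩ := Nat.exists_eq_add_of_le hn
  rw [hk]
  have h1 := reachN_eq_of_fix (G := G) hfix k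
  have h2 := reachN_eq_of_fix (G := G) hfix (k + 1)
  rw [← reachN_succ, Nat.add_assoc, h1, h2]

/-- A set stable under expansion and containing `u` contains every vertex connected to `u`. -/
theorem mem_of_conn_of_expand_eq {ω : Config E} {s : Finset V} (hs : G.expand ω s = s) {u : V}
    (hu : u ∈ s) {v : V} (h : G.Conn ω u v) : v ∈ s := by
  unfold Conn at h
  induction h with
  | refl => exact hu
  | tail _ hab ih =>
    rw [← hs]
    exact mem_expand.2 (Or.inr ⟨_, ih, hab⟩)

/-- The source is in its reach set. -/
theorem self_mem_reach (ω : Config E) (u : V) : u ∈ G.reach ω u := by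
  unfold reach
  have h0 : u ∈ G.reachN ω u 0 := by rw [reachN_zero]; exact Finset.mem_singleton_self u
  have : ∀ n, u ∈ G.reachN ω u n := fun n => by
    induction n with
    | zero => exact h0
    | succ n ih => exact reachN_subset_succ ω u n ih
  exact this _

/-- **Completeness and soundness**: `v` is in the reach set of `u` iff `u ↔ v`. -/
theorem mem_reach_iff (ω : Config E) (u v : V) : v ∈ G.reach ω u ↔ G.Conn ω u v :=
  ⟨conn_of_mem_reachN, mem_of_conn_of_expand_eq (expand_reach ω u) (self_mem_reach ω u)⟩

/-- The computable connectivity agrees with `decide (G.Conn ω u v)` for any instance. -/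
theorem connD_eq_decide (ω : Config E) (u v : V) [Decidable (G.Conn ω u v)] :
    G.connD ω u v = decide (G.Conn ω u v) := by
  unfold connD
  exact decide_eq_decide.2 (mem_reach_iff ω u v)

end MultiGraph

end PercRepro
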